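import Summits.QuantumFields.YangMills.Theorems.BalabanUVNodesN11NoExpansionDiagonalCoPR

/-!
# DAG node N11 — THE NO-EXPANSION 𝐓-STEP ALONG THE DIAGONAL, CLAUSE-KEYED: from the §2 dichotomy of `ρ_k` AT THE OLD DIAGONAL TERM `init s′` for ONE witness
# `(t₀, E₀)` (not the whole S-law) to the 𝐓-image dichotomy at `s′` with the SAME constant `E₀` — the step dag-n11-e's diagonal induction «∀ k ≤ K, §2 clause at
# the all-large-field index» consumes (ASK l.≈19990), at a free residual `Z`, at the v1.6 `CoPR` record, at the cured residual, and at K0a's K0⁶ witness family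

Cell `pub-ymgap`, YM-PLAN Track A (HUMAN RULING D-0062), seat `pub-ymgap-dag-n11-d` (g7; R134 fan-out seat N11 [B14], strategy s2), route `BalabanUVNodes`
rev 22, item K1⁶ `StabilityBAtRecordR13SepCoPR` = stmt-QuantumFields-20507 (helper, count-neutral).  [III] = [Balaban1988Convergent].  Over this seat's
`…NoExpansionDiagonalAtZ` (p532335) ∕ `…NoExpansionDiagonalCoPR` (p532711) ∕ `…ResidualPinCompletion` (p531014), node00-def-T FILE 25 (`WtOfRecord₁₃R`,
`Provisos₁₃CoPR.tstep`) and node00-def-K0a FILES 17∕18 (`ZrOfRecord₁₃` faces, `Stage13RParams.ofCured`).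

WHY THIS FILE.  `hasSect2FormAtZ_clause_succ_atZ_of_allLarge_pin` (p532335 §3) takes the whole S-law `hS : HasSect2FormAEZ … k …` (∃ of a sequence-indexed
witness `(t, E)` with laws at EVERY old sequence) but its proof reads only the dichotomy AT `init s′` for the one pair `(t (init s′), E (init s′))`, and returns
`∃ E′`.  dag-n11-e's diagonal induction needs the step with exactly that input and an EXPLICIT output constant.  This file re-keys the same proof: input = the
dichotomy `slot_k(init s′) ≡ 0 ∨ slot_k(init s′) = 𝐓…e^{A_k}[t₀, E₀]` `dU`-a.e. on `{χ_k ≠ 0}`; output = the dichotomy for `slotT_{k+1}(s′)` with the constant `E₀`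
and any new term-value witness `t′`; the displayed measurability ∕ bound of the old branch are asked for `(t₀, E₀)` only.

WHAT THIS FILE PROVES (0 `sorry`, 0 `def`, standard axioms; `N`-generic).  ★ `clause_succ_atZ_of_allLarge_pin_of_clause` (free residual `Z`; hypotheses `hk hM hζu
hloc hq s hall t₀ E₀ hid hZ hmw hmB hCB t′`) · `clause_succ_CoPR_of_allLarge_pin_of_clause` (`Z := θ.Zr p`) · ★★ `clause_succ_CoPR_of_Zr_eq_ZrOfRecord_of_clause`
(cured residual: `hloc`∕`hq`∕`hZ` DISCHARGED by K0a's faces) · `clause_succ_CoPR_of_provisos_of_clause` (+ `hζu`∕`hmw` from `Provisos₁₃CoPR`) ·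
★★ `clause_succ_ofCured_of_provisosCore_of_clause` (at `Stage13RParams.ofCured θ₀`, from `θ₀.Provisos₁₃Core`: the diagonal 𝐓-step of dag-n11-e's induction).

HONEST FRAMING.  The proof is p532335 §3's VERBATIM with the S-law witness replaced by the displayed pair `(t₀, E₀)` (kernel bookkeeping); the diagonal only;
`hmB`∕`hCB` stay displayed (restricted-averaging marginal density unbounded in the tree); nothing of Bałaban's asserted; N11 NOT discharged; counts unmoved (typed
28∕28 · discharged 5∕28).  One finite four-torus programme at fixed `ε = L^{−K}`; NOT ℝ⁴, NOT OS, NOT a mass gap, NOT Clay.  Sources: [III] Theorem p.245, (2.18)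
p.257, (2.20)–(2.23) p.258, (3.16)–(3.21) pp.268–269, (3.24)–(3.25) p.270, (1.11) p.248.
-/

noncomputable section

open MeasureTheory
open scoped BigOperators Matrix.Norms.L2Operator

namespace Summit.QuantumFields.YangMills.Theorems.BalabanUVNodesN11NoExpansionDiagonalClauseStep

open Literature.MathematicalPhysics.QuantumFieldTheory.Balaban1983to89 T4Continuum Node00 Node00.Tk DagBinding
open B15DeterminingSets
open BalabanUVNodesN11TkBranchLinearLocal (tkBranchOfRecord_const_mul tkBranchOfRecord_pairCfgAt_eq_baseCfg)
open BalabanUVNodesN11NoExpansionZetaSpecSucc (slotsT_succ_ae_eq_sect2Slot_of_zetaSpecAt noExpIntegrandAt_eq_zetaFactor_mul)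
open BalabanUVNodesN11NoExpansionAllLargeCoP (init_allLarge admSOfRecord_init_eq_of_allLarge sect2Operand_succ_eq_const_mul_of_allLarge
  sect2Operand_local_of_allLarge)
open BalabanUVNodesN11NoExpansionDiagonalAtZ (tkWeightsOfRecordP_w_empty_eq_one oldFactors_agree_atZ_of_allLarge)
open BalabanUVNodesN11ResidualPinCompletion (seq_eq_seqAllLargeOfRecord)

variable {F : T4Family} {N : ℕ} [NeZero N]

/-! ## §1. ★ The clause-keyed 𝐓-step at a free residual `Z` -/

section AtZ

variable (θ : Stage13Params F N) (p : B12.RunParams) (Z : TkResidualW F N (FluctV N) p.K)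

/-- **★ THE NO-EXPANSION 𝐓-STEP ALONG THE DIAGONAL, CLAUSE-KEYED, AT THE WEIGHTS OVER A FREE RESIDUAL `Z`.**  Let `s′` be the all-large-field new sequence
of length `k+1` (`k < K`, `1 ≤ M`) and suppose the §2 dichotomy of the post-𝐑 slot family holds AT `init s′` for ONE term-value witness `t₀` and constant `E₀`
(`hid`).  Under 12b's locality law of `Z`, `quad_j(∅) = 0`, the generation-`k` pin `Z.ζ0 k T (V_k, V_{k+1}) = w_k(s′)(V_k, V̄_k)`, unity of def-T's `ζ`, the joint
measurability of `w_k(s′)` and the displayed measurability ∕ bound of the old branch at `(t₀, E₀)`: the 𝐓-image dichotomy at `s′` holds for every new witness `t′`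
WITH THE SAME CONSTANT `E₀` (`E_{k+1}(s′) = E_k(init s′)`). [cite: Balaban1988Convergent, Theorem p.245, (3.24)–(3.25) p.270, (2.18) p.257, (2.20)–(2.23) p.258, (3.16) p.268, (1.11) p.248] -/
theorem clause_succ_atZ_of_allLarge_pin_of_clause {k : ℕ} (hk : k < p.K) (hM : 1 ≤ θ.τ9.M) (hζu : IsZetaUnity F N θ.ν θ.τ9.M θ.ζ)
    (hloc : Z.LocalLaws) (hq : ∀ (j : ℕ) (ω : MultiCfg (F.P p.K) (SU N) (FluctV N)), Z.quad j ∅ ω = 0)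
    (s : SeqOfRecord F θ.ν θ.τ9.M (gOfRecord₁₃ F N θ p) p.K (k + 1)) (hall : ∀ j, 1 ≤ j → j ≤ k + 1 → s.Ω j = ∅)
    (t₀ : Sect2.TermValues (F.P p.K) (MatA N) (FluctV N) θ.τ9.M) (E₀ : ℝ)
    (hid : slotsOfRecord F N θ.ν θ.τ9 (EOfRecord₁₃ F N θ) (wOfRecord₉ F N θ.toStage9Params) θ.ppSel p (gOfRecord₁₃ F N θ p) k s.init = 0 ∨
      ∀ᵐ U₀ ∂fieldMeasure (F.P p.K) k (SU N),
        chiSeqOfRecord F N θ.ν θ.τ9.M (gOfRecord₁₃ F N θ p) p.K k s.init U₀ ≠ 0 →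
          slotsOfRecord F N θ.ν θ.τ9 (EOfRecord₁₃ F N θ) (wOfRecord₉ F N θ.toStage9Params) θ.ppSel p (gOfRecord₁₃ F N θ p) k s.init U₀ =
            sect2Slot F N (FluctV N) p.K (settingOfRecord₁₃ F N θ p) (θ.Rz p.K) (tkWeightsOfRecordP F N (FluctV N) θ.ν θ.A₁ p (gOfRecord₁₃ F N θ p) Z) s.init t₀ E₀
              (UbgOfRecord₁₃CoP F N θ p k s.init) U₀)
    (hZ : ∀ (V' : GaugeField (F.P p.K) (k + 1) (SU N)) (U₀ : GaugeField (F.P p.K) k (SU N)),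
      Z.ζ0 k Set.univ (pairCfgAt (V := FluctV N) k V' U₀) =
        wOfRecord₉ F N θ.toStage9Params p (gOfRecord₁₃ F N θ p) k s U₀ ((avOfRecord F N p.K k).avg U₀))
    (hmw : Measurable fun z : GaugeField (F.P p.K) (k + 1) (SU N) × GaugeField (F.P p.K) k (SU N) =>
      wOfRecord₉ F N θ.toStage9Params p (gOfRecord₁₃ F N θ p) k s z.2 z.1)
    {C : ℝ}
    (hmB : Measurable fun U₀ : GaugeField (F.P p.K) k (SU N) =>
        tkBranchOfRecord F N (FluctV N) θ.ν θ.τ9.M _ p.K (tkWeightsOfRecordP F N (FluctV N) θ.ν θ.A₁ p (gOfRecord₁₃ F N θ p) Z) s.init (fun _ => ∅) k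
          (fun ω => sect2Operand F N (FluctV N) p.K (settingOfRecord₁₃ F N θ p) (θ.Rz p.K) s.init t₀ E₀ (UbgOfRecord₁₃CoP F N θ p k s.init)
            ((fun _ => ∅ : ℕ → Set (Site (F.P p.K) 0)), fun j => (ω j).2) (fun j => (ω j).1))
          (baseCfg (V := FluctV N) k U₀))
    (hCB : ∀ U₀ : GaugeField (F.P p.K) k (SU N),
      |tkBranchOfRecord F N (FluctV N) θ.ν θ.τ9.M _ p.K (tkWeightsOfRecordP F N (FluctV N) θ.ν θ.A₁ p (gOfRecord₁₃ F N θ p) Z) s.init (fun _ => ∅) k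
          (fun ω => sect2Operand F N (FluctV N) p.K (settingOfRecord₁₃ F N θ p) (θ.Rz p.K) s.init t₀ E₀ (UbgOfRecord₁₃CoP F N θ p k s.init)
            ((fun _ => ∅ : ℕ → Set (Site (F.P p.K) 0)), fun j => (ω j).2) (fun j => (ω j).1))
          (baseCfg (V := FluctV N) k U₀)| ≤ C)
    (t' : Sect2.TermValues (F.P p.K) (MatA N) (FluctV N) θ.τ9.M) :
    slotsTOfRecord F N θ.ν θ.τ9 (EOfRecord₁₃ F N θ) (wOfRecord₉ F N θ.toStage9Params) θ.ppSel p (gOfRecord₁₃ F N θ p) (k + 1) s = 0 ∨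
      ∀ᵐ V' ∂fieldMeasure (F.P p.K) (k + 1) (SU N),
        chiSeqOfRecord F N θ.ν θ.τ9.M (gOfRecord₁₃ F N θ p) p.K (k + 1) s V' ≠ 0 →
          slotsTOfRecord F N θ.ν θ.τ9 (EOfRecord₁₃ F N θ) (wOfRecord₉ F N θ.toStage9Params) θ.ppSel p
              (gOfRecord₁₃ F N θ p) (k + 1) s V' =
            sect2Slot F N (FluctV N) p.K (settingOfRecord₁₃ F N θ p) (θ.Rz p.K) (tkWeightsOfRecordP F N (FluctV N) θ.ν θ.A₁ p (gOfRecord₁₃ F N θ p) Z) s t' E₀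
              (UbgOfRecord₁₃CoP F N θ p (k + 1) s) V' := by
  classical
  have hinit := init_allLarge θ p s hall
  have hΩtop : s.Ω (k + 1) = ∅ := hall (k + 1) (by omega) le_rfl
  -- `χ_k(init s′) ≡ 1`: no front factor along the history
  have hχ : ∀ U₀ : GaugeField (F.P p.K) k (SU N), chiSeqOfRecord F N θ.ν θ.τ9.M (gOfRecord₁₃ F N θ p) p.K k s.init U₀ = 1 := by
    intro U₀
    rcases Nat.eq_zero_or_pos k with hk0 | hkpos
    · subst hk0; exact chiSeqOfRecord_zero F N θ.ν θ.τ9.M _ p.K s.init U₀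
    · exact chiSeqOfRecord_eq_one_of_Omega_empty F N θ.ν θ.τ9.M _ p.K k s.init (hinit k hkpos le_rfl) U₀
  rcases hid with h0 | hid
  · -- absent slot at `init s′` ⇒ absent pre-𝐑 slot at `s′`
    refine Or.inl ?_
    funext V'
    rw [slotsTOfRecord_succ_apply, h0]
    show transportOfRecord F N p.K k (fun U => _ * (_ * (0 : ℝ))) V' = 0
    simp only [mul_zero]
    show T4AveragingDisintegration.kernelTransport _ _ _ (fun _ => (0 : ℝ)) V' = 0
    simp only [T4AveragingDisintegration.kernelTransport, integral_zero, mul_zero]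
  · refine Or.inr ?_
    -- the old index is `{∅}`: every hypothesis per old branch is one statement about the all-empty branch
    have hA := admSOfRecord_init_eq_of_allLarge θ p s hall
    -- the new integrand of the all-empty branch, closed form: `w_k(s′)(U₀, Ū₀) · e^{E_k − E_{k+1}} · B(U₀)` with `E_{k+1} = E_k`
    have hold := oldFactors_agree_atZ_of_allLarge θ p Z hM hloc hq s hall t₀ t' E₀ E₀
    have hfac : ∀ (V' : GaugeField (F.P p.K) (k + 1) (SU N)) (U₀ : GaugeField (F.P p.K) k (SU N)),
        (tkWeightsOfRecordP F N (FluctV N) θ.ν θ.A₁ p (gOfRecord₁₃ F N θ p) Z).ζ k Set.univ (pairCfgAt (V := FluctV N) k V' U₀) * (tkWeightsOfRecordP F N (FluctV N) θ.ν θ.A₁ p (gOfRecord₁₃ F N θ p) Z).w k ∅ ∅ ∅ (pairCfgAt (V := FluctV N) k V' U₀) =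
          wOfRecord₉ F N θ.toStage9Params p (gOfRecord₁₃ F N θ p) k s U₀ ((avOfRecord F N p.K k).avg U₀) := by
      intro V' U₀
      rw [tkWeightsOfRecordP_w_empty_eq_one hq, mul_one]
      exact (hZ V' U₀)
    have hint : ∀ (V' : GaugeField (F.P p.K) (k + 1) (SU N)) (U₀ : GaugeField (F.P p.K) k (SU N)),
        noExpIntegrandAt F N (FluctV N) p.K k (tkWeightsOfRecordP F N (FluctV N) θ.ν θ.A₁ p (gOfRecord₁₃ F N θ p) Z)
            (tkBranchOfRecord F N (FluctV N) θ.ν θ.τ9.M _ p.K (tkWeightsOfRecordP F N (FluctV N) θ.ν θ.A₁ p (gOfRecord₁₃ F N θ p) Z) s.init (fun _ => ∅) k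
              (fun ω => sect2Operand F N (FluctV N) p.K (settingOfRecord₁₃ F N θ p) (θ.Rz p.K) s t' E₀ (UbgOfRecord₁₃CoP F N θ p (k + 1) s)
                ((fun _ => ∅ : ℕ → Set (Site (F.P p.K) 0)), fun j => (ω j).2) (fun j => (ω j).1)))
            V' U₀ =
          wOfRecord₉ F N θ.toStage9Params p (gOfRecord₁₃ F N θ p) k s U₀ ((avOfRecord F N p.K k).avg U₀) *
            tkBranchOfRecord F N (FluctV N) θ.ν θ.τ9.M _ p.K (tkWeightsOfRecordP F N (FluctV N) θ.ν θ.A₁ p (gOfRecord₁₃ F N θ p) Z) s.init (fun _ => ∅) k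
              (fun ω => sect2Operand F N (FluctV N) p.K (settingOfRecord₁₃ F N θ p) (θ.Rz p.K) s.init t₀ E₀
                (UbgOfRecord₁₃CoP F N θ p k s.init) ((fun _ => ∅ : ℕ → Set (Site (F.P p.K) 0)), fun j => (ω j).2) (fun j => (ω j).1))
              (baseCfg (V := FluctV N) k U₀) := by
      intro V' U₀
      rw [noExpIntegrandAt_eq_zetaFactor_mul, hfac, hold V' U₀, sub_self, Real.exp_zero, one_mul]
    -- measurability ∕ bound of the new integrand (displayed data on `w_k(s′)` and on the old branch)
    have hw0 : ∀ U₀ : GaugeField (F.P p.K) k (SU N), 0 ≤ wOfRecord₉ F N θ.toStage9Params p (gOfRecord₁₃ F N θ p) k s U₀ ((avOfRecord F N p.K k).avg U₀) :=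
      fun U₀ => wOfRecord_nonneg_of_Omega_empty F N θ.ν θ.τ9.M θ.A₁ p (gOfRecord₁₃ F N θ p) k hζu s hΩtop U₀ _
    have hw1 : ∀ U₀ : GaugeField (F.P p.K) k (SU N), wOfRecord₉ F N θ.toStage9Params p (gOfRecord₁₃ F N θ p) k s U₀ ((avOfRecord F N p.K k).avg U₀) ≤ 1 :=
      fun U₀ => wOfRecord_le_one_of_Omega_empty F N θ.ν θ.τ9.M θ.A₁ p (gOfRecord₁₃ F N θ p) k hζu s hΩtop U₀ _
    have hg : Measurable fun U₀ : GaugeField (F.P p.K) k (SU N) =>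
        ((((avOfRecord F N p.K k).avg U₀), U₀) : GaugeField (F.P p.K) (k + 1) (SU N) × GaugeField (F.P p.K) k (SU N)) :=
      (avOfRecord_measurable F N p.K k).prodMk measurable_id
    have hgraph : Measurable fun U₀ : GaugeField (F.P p.K) k (SU N) =>
        wOfRecord₉ F N θ.toStage9Params p (gOfRecord₁₃ F N θ p) k s U₀ ((avOfRecord F N p.K k).avg U₀) := by
      simpa only [Function.comp_def] using hmw.comp hg
    refine slotsT_succ_ae_eq_sect2Slot_of_zetaSpecAt θ p hk s hΩtop (tkWeightsOfRecordP F N (FluctV N) θ.ν θ.A₁ p (gOfRecord₁₃ F N θ p) Z) t₀ E₀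
      (UbgOfRecord₁₃CoP F N θ p k s.init) hid hχ t' E₀ (UbgOfRecord₁₃CoP F N θ p (k + 1) s) (κ := 1) (c := 1) (C := C) (one_mul 1)
      ?_ ?_ ?_ ?_
    · -- old-factor agreement on the old index `{∅}`
      intro S hS V' U₀
      rw [hA, Finset.mem_singleton] at hS
      subst hS
      rw [hold V' U₀, sub_self, Real.exp_zero]
    · -- the generation-`k` spec with `c = 1`
      intro U₀
      rw [hfac, one_mul]
    · -- measurability of the new integrand per old branch
      intro S hS
      rw [hA, Finset.mem_singleton] at hS
      subst hS
      have hfun : Function.uncurry (noExpIntegrandAt F N (FluctV N) p.K k (tkWeightsOfRecordP F N (FluctV N) θ.ν θ.A₁ p (gOfRecord₁₃ F N θ p) Z)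
          (tkBranchOfRecord F N (FluctV N) θ.ν θ.τ9.M _ p.K (tkWeightsOfRecordP F N (FluctV N) θ.ν θ.A₁ p (gOfRecord₁₃ F N θ p) Z) s.init (fun _ => ∅) k
            (fun ω => sect2Operand F N (FluctV N) p.K (settingOfRecord₁₃ F N θ p) (θ.Rz p.K) s t' E₀ (UbgOfRecord₁₃CoP F N θ p (k + 1) s)
              ((fun _ => ∅ : ℕ → Set (Site (F.P p.K) 0)), fun j => (ω j).2) (fun j => (ω j).1)))) =
          fun z => wOfRecord₉ F N θ.toStage9Params p (gOfRecord₁₃ F N θ p) k s z.2 ((avOfRecord F N p.K k).avg z.2) *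
            tkBranchOfRecord F N (FluctV N) θ.ν θ.τ9.M _ p.K (tkWeightsOfRecordP F N (FluctV N) θ.ν θ.A₁ p (gOfRecord₁₃ F N θ p) Z) s.init (fun _ => ∅) k
              (fun ω => sect2Operand F N (FluctV N) p.K (settingOfRecord₁₃ F N θ p) (θ.Rz p.K) s.init t₀ E₀
                (UbgOfRecord₁₃CoP F N θ p k s.init) ((fun _ => ∅ : ℕ → Set (Site (F.P p.K) 0)), fun j => (ω j).2) (fun j => (ω j).1))
              (baseCfg (V := FluctV N) k z.2) := by
        funext z
        rcases z with ⟨V', U₀⟩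
        exact hint V' U₀
      rw [hfun]
      exact (hgraph.comp measurable_snd).mul (hmB.comp measurable_snd)
    · -- bound of the new integrand per old branch: `|w·B| ≤ C`
      intro S hS V' U₀
      rw [hA, Finset.mem_singleton] at hS
      subst hS
      rw [hint V' U₀, abs_mul, abs_of_nonneg (hw0 U₀)]
      have hC0 : 0 ≤ C := (abs_nonneg _).trans (hCB U₀)
      calc wOfRecord₉ F N θ.toStage9Params p (gOfRecord₁₃ F N θ p) k s U₀ ((avOfRecord F N p.K k).avg U₀) * _
          ≤ 1 * C := mul_le_mul (hw1 U₀) (hCB U₀) (abs_nonneg _) zero_le_one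
        _ = C := one_mul C


end AtZ

/-! ## §2. At the v1.6 `CoPR` record, at the cured residual, and at K0a's cured witness family -/

section CoPR

variable (θ : Stage13RParams F N) (p : B12.RunParams)

/-- **The clause-keyed 𝐓-step at the run's v1.6 weights `WtOfRecord₁₃R θ p`** (§1 at `Z := θ.Zr p`), pins as hypotheses.
[cite: Balaban1988Convergent, Theorem p.245, (3.24)–(3.25) p.270, (1.11) p.248] -/
theorem clause_succ_CoPR_of_allLarge_pin_of_clause {k : ℕ} (hk : k < p.K) (hM : 1 ≤ θ.τ9.M) (hζu : IsZetaUnity F N θ.ν θ.τ9.M θ.ζ)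
    (hloc : (θ.Zr p).LocalLaws) (hq : ∀ (j : ℕ) (ω : MultiCfg (F.P p.K) (SU N) (FluctV N)), (θ.Zr p).quad j ∅ ω = 0)
    (s : SeqOfRecord F θ.ν θ.τ9.M (gOfRecord₁₃ F N θ.toStage13Params p) p.K (k + 1)) (hall : ∀ j, 1 ≤ j → j ≤ k + 1 → s.Ω j = ∅)
    (t₀ : Sect2.TermValues (F.P p.K) (MatA N) (FluctV N) θ.τ9.M) (E₀ : ℝ)
    (hid : slotsOfRecord F N θ.ν θ.τ9 (EOfRecord₁₃ F N θ.toStage13Params) (wOfRecord₉ F N θ.toStage9Params) θ.ppSel p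
        (gOfRecord₁₃ F N θ.toStage13Params p) k s.init = 0 ∨
      ∀ᵐ U₀ ∂fieldMeasure (F.P p.K) k (SU N),
        chiSeqOfRecord F N θ.ν θ.τ9.M (gOfRecord₁₃ F N θ.toStage13Params p) p.K k s.init U₀ ≠ 0 →
          slotsOfRecord F N θ.ν θ.τ9 (EOfRecord₁₃ F N θ.toStage13Params) (wOfRecord₉ F N θ.toStage9Params) θ.ppSel p
              (gOfRecord₁₃ F N θ.toStage13Params p) k s.init U₀ =
            sect2Slot F N (FluctV N) p.K (settingOfRecord₁₃ F N θ.toStage13Params p) (θ.Rz p.K) (WtOfRecord₁₃R F N θ p) s.init t₀ E₀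
              (UbgOfRecord₁₃CoP F N θ.toStage13Params p k s.init) U₀)
    (hZ : ∀ (V' : GaugeField (F.P p.K) (k + 1) (SU N)) (U₀ : GaugeField (F.P p.K) k (SU N)),
      (θ.Zr p).ζ0 k Set.univ (pairCfgAt (V := FluctV N) k V' U₀) =
        wOfRecord₉ F N θ.toStage9Params p (gOfRecord₁₃ F N θ.toStage13Params p) k s U₀ ((avOfRecord F N p.K k).avg U₀))
    (hmw : Measurable fun z : GaugeField (F.P p.K) (k + 1) (SU N) × GaugeField (F.P p.K) k (SU N) =>
      wOfRecord₉ F N θ.toStage9Params p (gOfRecord₁₃ F N θ.toStage13Params p) k s z.2 z.1)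
    {C : ℝ}
    (hmB : Measurable fun U₀ : GaugeField (F.P p.K) k (SU N) =>
        tkBranchOfRecord F N (FluctV N) θ.ν θ.τ9.M _ p.K (WtOfRecord₁₃R F N θ p) s.init (fun _ => ∅) k
          (fun ω => sect2Operand F N (FluctV N) p.K (settingOfRecord₁₃ F N θ.toStage13Params p) (θ.Rz p.K) s.init t₀ E₀
            (UbgOfRecord₁₃CoP F N θ.toStage13Params p k s.init) ((fun _ => ∅ : ℕ → Set (Site (F.P p.K) 0)), fun j => (ω j).2) (fun j => (ω j).1))
          (baseCfg (V := FluctV N) k U₀))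
    (hCB : ∀ U₀ : GaugeField (F.P p.K) k (SU N),
      |tkBranchOfRecord F N (FluctV N) θ.ν θ.τ9.M _ p.K (WtOfRecord₁₃R F N θ p) s.init (fun _ => ∅) k
          (fun ω => sect2Operand F N (FluctV N) p.K (settingOfRecord₁₃ F N θ.toStage13Params p) (θ.Rz p.K) s.init t₀ E₀
            (UbgOfRecord₁₃CoP F N θ.toStage13Params p k s.init) ((fun _ => ∅ : ℕ → Set (Site (F.P p.K) 0)), fun j => (ω j).2) (fun j => (ω j).1))
          (baseCfg (V := FluctV N) k U₀)| ≤ C)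
    (t' : Sect2.TermValues (F.P p.K) (MatA N) (FluctV N) θ.τ9.M) :
    slotsTOfRecord F N θ.ν θ.τ9 (EOfRecord₁₃ F N θ.toStage13Params) (wOfRecord₉ F N θ.toStage9Params) θ.ppSel p
        (gOfRecord₁₃ F N θ.toStage13Params p) (k + 1) s = 0 ∨
      ∀ᵐ V' ∂fieldMeasure (F.P p.K) (k + 1) (SU N),
        chiSeqOfRecord F N θ.ν θ.τ9.M (gOfRecord₁₃ F N θ.toStage13Params p) p.K (k + 1) s V' ≠ 0 →
          slotsTOfRecord F N θ.ν θ.τ9 (EOfRecord₁₃ F N θ.toStage13Params) (wOfRecord₉ F N θ.toStage9Params) θ.ppSel p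
              (gOfRecord₁₃ F N θ.toStage13Params p) (k + 1) s V' =
            sect2Slot F N (FluctV N) p.K (settingOfRecord₁₃ F N θ.toStage13Params p) (θ.Rz p.K) (WtOfRecord₁₃R F N θ p) s t' E₀
              (UbgOfRecord₁₃CoP F N θ.toStage13Params p (k + 1) s) V' :=
  clause_succ_atZ_of_allLarge_pin_of_clause θ.toStage13Params p (θ.Zr p) hk hM hζu hloc hq s hall t₀ E₀ hid hZ hmw hmB hCB t'

/-- **★★ The clause-keyed 𝐓-step AT THE CURED RESIDUAL** `θ.Zr p = ZrOfRecord₁₃ θ.toStage13Params p`: 12b's law, `quad ≡ 0` and the generation-`k` pin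
DISCHARGED by K0a's faces (after `seq_eq_seqAllLargeOfRecord`). [cite: Balaban1988Convergent, Theorem p.245, (3.24)–(3.25) p.270, (3.16)–(3.20) pp.268–269, (1.11) p.248] -/
theorem clause_succ_CoPR_of_Zr_eq_ZrOfRecord_of_clause (hZr : θ.Zr p = ZrOfRecord₁₃ F N θ.toStage13Params p)
    {k : ℕ} (hk : k < p.K) (hM : 1 ≤ θ.τ9.M) (hζu : IsZetaUnity F N θ.ν θ.τ9.M θ.ζ)
    (s : SeqOfRecord F θ.ν θ.τ9.M (gOfRecord₁₃ F N θ.toStage13Params p) p.K (k + 1)) (hall : ∀ j, 1 ≤ j → j ≤ k + 1 → s.Ω j = ∅)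
    (t₀ : Sect2.TermValues (F.P p.K) (MatA N) (FluctV N) θ.τ9.M) (E₀ : ℝ)
    (hid : slotsOfRecord F N θ.ν θ.τ9 (EOfRecord₁₃ F N θ.toStage13Params) (wOfRecord₉ F N θ.toStage9Params) θ.ppSel p
        (gOfRecord₁₃ F N θ.toStage13Params p) k s.init = 0 ∨
      ∀ᵐ U₀ ∂fieldMeasure (F.P p.K) k (SU N),
        chiSeqOfRecord F N θ.ν θ.τ9.M (gOfRecord₁₃ F N θ.toStage13Params p) p.K k s.init U₀ ≠ 0 →
          slotsOfRecord F N θ.ν θ.τ9 (EOfRecord₁₃ F N θ.toStage13Params) (wOfRecord₉ F N θ.toStage9Params) θ.ppSel p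
              (gOfRecord₁₃ F N θ.toStage13Params p) k s.init U₀ =
            sect2Slot F N (FluctV N) p.K (settingOfRecord₁₃ F N θ.toStage13Params p) (θ.Rz p.K) (WtOfRecord₁₃R F N θ p) s.init t₀ E₀
              (UbgOfRecord₁₃CoP F N θ.toStage13Params p k s.init) U₀)
    (hmw : Measurable fun z : GaugeField (F.P p.K) (k + 1) (SU N) × GaugeField (F.P p.K) k (SU N) =>
      wOfRecord₉ F N θ.toStage9Params p (gOfRecord₁₃ F N θ.toStage13Params p) k s z.2 z.1)
    {C : ℝ}
    (hmB : Measurable fun U₀ : GaugeField (F.P p.K) k (SU N) =>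
        tkBranchOfRecord F N (FluctV N) θ.ν θ.τ9.M _ p.K (WtOfRecord₁₃R F N θ p) s.init (fun _ => ∅) k
          (fun ω => sect2Operand F N (FluctV N) p.K (settingOfRecord₁₃ F N θ.toStage13Params p) (θ.Rz p.K) s.init t₀ E₀
            (UbgOfRecord₁₃CoP F N θ.toStage13Params p k s.init) ((fun _ => ∅ : ℕ → Set (Site (F.P p.K) 0)), fun j => (ω j).2) (fun j => (ω j).1))
          (baseCfg (V := FluctV N) k U₀))
    (hCB : ∀ U₀ : GaugeField (F.P p.K) k (SU N),
      |tkBranchOfRecord F N (FluctV N) θ.ν θ.τ9.M _ p.K (WtOfRecord₁₃R F N θ p) s.init (fun _ => ∅) k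
          (fun ω => sect2Operand F N (FluctV N) p.K (settingOfRecord₁₃ F N θ.toStage13Params p) (θ.Rz p.K) s.init t₀ E₀
            (UbgOfRecord₁₃CoP F N θ.toStage13Params p k s.init) ((fun _ => ∅ : ℕ → Set (Site (F.P p.K) 0)), fun j => (ω j).2) (fun j => (ω j).1))
          (baseCfg (V := FluctV N) k U₀)| ≤ C)
    (t' : Sect2.TermValues (F.P p.K) (MatA N) (FluctV N) θ.τ9.M) :
    slotsTOfRecord F N θ.ν θ.τ9 (EOfRecord₁₃ F N θ.toStage13Params) (wOfRecord₉ F N θ.toStage9Params) θ.ppSel p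
        (gOfRecord₁₃ F N θ.toStage13Params p) (k + 1) s = 0 ∨
      ∀ᵐ V' ∂fieldMeasure (F.P p.K) (k + 1) (SU N),
        chiSeqOfRecord F N θ.ν θ.τ9.M (gOfRecord₁₃ F N θ.toStage13Params p) p.K (k + 1) s V' ≠ 0 →
          slotsTOfRecord F N θ.ν θ.τ9 (EOfRecord₁₃ F N θ.toStage13Params) (wOfRecord₉ F N θ.toStage9Params) θ.ppSel p
              (gOfRecord₁₃ F N θ.toStage13Params p) (k + 1) s V' =
            sect2Slot F N (FluctV N) p.K (settingOfRecord₁₃ F N θ.toStage13Params p) (θ.Rz p.K) (WtOfRecord₁₃R F N θ p) s t' E₀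
              (UbgOfRecord₁₃CoP F N θ.toStage13Params p (k + 1) s) V' := by
  obtain rfl : s = seqAllLargeOfRecord F θ.ν θ.τ9.M (gOfRecord₁₃ F N θ.toStage13Params p) p.K (k + 1) :=
    seq_eq_seqAllLargeOfRecord θ.ν θ.τ9.M _ p.K (k + 1) s hall
  refine clause_succ_CoPR_of_allLarge_pin_of_clause θ p hk hM hζu ?_ (fun j ω => ?_) _ hall t₀ E₀ hid (fun V' U₀ => ?_) hmw hmB hCB t'
  · rw [hZr]
    exact localLaws_ZrOfRecord₁₃
  · rw [hZr, ZrOfRecord₁₃_quad]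
  · rw [hZr]
    exact ZrOfRecord₁₃_ζ0_univ_pairCfgAt hk V' U₀

/-- **… with `hζu` ∕ `hmw` from the provisos rows** (`zetaUnity`; `measω` through `Provisos₁₃CoPR.tstep … .measW`).
[cite: Balaban1988Convergent, Theorem p.245, (3.24)–(3.25) p.270, (3.2)–(3.5) pp.264–265] -/
theorem clause_succ_CoPR_of_provisos_of_clause (hZr : θ.Zr p = ZrOfRecord₁₃ F N θ.toStage13Params p) (h : θ.Provisos₁₃CoPR F N)
    {k : ℕ} (hk : k < p.K) (hM : 1 ≤ θ.τ9.M)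
    (s : SeqOfRecord F θ.ν θ.τ9.M (gOfRecord₁₃ F N θ.toStage13Params p) p.K (k + 1)) (hall : ∀ j, 1 ≤ j → j ≤ k + 1 → s.Ω j = ∅)
    (t₀ : Sect2.TermValues (F.P p.K) (MatA N) (FluctV N) θ.τ9.M) (E₀ : ℝ)
    (hid : slotsOfRecord F N θ.ν θ.τ9 (EOfRecord₁₃ F N θ.toStage13Params) (wOfRecord₉ F N θ.toStage9Params) θ.ppSel p
        (gOfRecord₁₃ F N θ.toStage13Params p) k s.init = 0 ∨
      ∀ᵐ U₀ ∂fieldMeasure (F.P p.K) k (SU N),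
        chiSeqOfRecord F N θ.ν θ.τ9.M (gOfRecord₁₃ F N θ.toStage13Params p) p.K k s.init U₀ ≠ 0 →
          slotsOfRecord F N θ.ν θ.τ9 (EOfRecord₁₃ F N θ.toStage13Params) (wOfRecord₉ F N θ.toStage9Params) θ.ppSel p
              (gOfRecord₁₃ F N θ.toStage13Params p) k s.init U₀ =
            sect2Slot F N (FluctV N) p.K (settingOfRecord₁₃ F N θ.toStage13Params p) (θ.Rz p.K) (WtOfRecord₁₃R F N θ p) s.init t₀ E₀
              (UbgOfRecord₁₃CoP F N θ.toStage13Params p k s.init) U₀)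
    {C : ℝ}
    (hmB : Measurable fun U₀ : GaugeField (F.P p.K) k (SU N) =>
        tkBranchOfRecord F N (FluctV N) θ.ν θ.τ9.M _ p.K (WtOfRecord₁₃R F N θ p) s.init (fun _ => ∅) k
          (fun ω => sect2Operand F N (FluctV N) p.K (settingOfRecord₁₃ F N θ.toStage13Params p) (θ.Rz p.K) s.init t₀ E₀
            (UbgOfRecord₁₃CoP F N θ.toStage13Params p k s.init) ((fun _ => ∅ : ℕ → Set (Site (F.P p.K) 0)), fun j => (ω j).2) (fun j => (ω j).1))
          (baseCfg (V := FluctV N) k U₀))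
    (hCB : ∀ U₀ : GaugeField (F.P p.K) k (SU N),
      |tkBranchOfRecord F N (FluctV N) θ.ν θ.τ9.M _ p.K (WtOfRecord₁₃R F N θ p) s.init (fun _ => ∅) k
          (fun ω => sect2Operand F N (FluctV N) p.K (settingOfRecord₁₃ F N θ.toStage13Params p) (θ.Rz p.K) s.init t₀ E₀
            (UbgOfRecord₁₃CoP F N θ.toStage13Params p k s.init) ((fun _ => ∅ : ℕ → Set (Site (F.P p.K) 0)), fun j => (ω j).2) (fun j => (ω j).1))
          (baseCfg (V := FluctV N) k U₀)| ≤ C)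
    (t' : Sect2.TermValues (F.P p.K) (MatA N) (FluctV N) θ.τ9.M) :
    slotsTOfRecord F N θ.ν θ.τ9 (EOfRecord₁₃ F N θ.toStage13Params) (wOfRecord₉ F N θ.toStage9Params) θ.ppSel p
        (gOfRecord₁₃ F N θ.toStage13Params p) (k + 1) s = 0 ∨
      ∀ᵐ V' ∂fieldMeasure (F.P p.K) (k + 1) (SU N),
        chiSeqOfRecord F N θ.ν θ.τ9.M (gOfRecord₁₃ F N θ.toStage13Params p) p.K (k + 1) s V' ≠ 0 →
          slotsTOfRecord F N θ.ν θ.τ9 (EOfRecord₁₃ F N θ.toStage13Params) (wOfRecord₉ F N θ.toStage9Params) θ.ppSel p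
              (gOfRecord₁₃ F N θ.toStage13Params p) (k + 1) s V' =
            sect2Slot F N (FluctV N) p.K (settingOfRecord₁₃ F N θ.toStage13Params p) (θ.Rz p.K) (WtOfRecord₁₃R F N θ p) s t' E₀
              (UbgOfRecord₁₃CoP F N θ.toStage13Params p (k + 1) s) V' :=
  clause_succ_CoPR_of_Zr_eq_ZrOfRecord_of_clause θ p hZr hk hM h.zetaUnity s hall t₀ E₀ hid ((h.tstep p k hk).measW s) hmB hCB t'

end CoPR

/-! ## §3. ★★ At K0a's cured witness family `Stage13RParams.ofCured θ₀` — the diagonal 𝐓-step of dag-n11-e's induction -/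

section OfCured

variable (θ₀ : Stage13Params F N) (p : B12.RunParams)

/-- **★★ THE DIAGONAL 𝐓-STEP AT THE CURED WITNESS FROM THE v1.5 CORE PROVISOS OF `θ₀`**: at `Stage13RParams.ofCured θ₀` (the K0⁶ witnesses) with
`θ₀.Provisos₁₃Core`, `k < K`, `1 ≤ M`: the §2 dichotomy of `ρ_k` at the old diagonal term `init s′` for `(t₀, E₀)` plus the displayed measurability ∕ bound of the
old branch at `(t₀, E₀)` give the 𝐓-image dichotomy at the new diagonal term `s′` with the SAME `E₀`, for every new term-value witness `t′`.
[cite: Balaban1988Convergent, Theorem p.245, (3.24)–(3.25) p.270, (2.18) p.257, (2.20)–(2.23) p.258, (3.16)–(3.20) pp.268–269, (1.11) p.248] -/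
theorem clause_succ_ofCured_of_provisosCore_of_clause (h : θ₀.Provisos₁₃Core F N) {k : ℕ} (hk : k < p.K) (hM : 1 ≤ θ₀.τ9.M)
    (s : SeqOfRecord F θ₀.ν θ₀.τ9.M (gOfRecord₁₃ F N θ₀ p) p.K (k + 1)) (hall : ∀ j, 1 ≤ j → j ≤ k + 1 → s.Ω j = ∅)
    (t₀ : Sect2.TermValues (F.P p.K) (MatA N) (FluctV N) θ₀.τ9.M) (E₀ : ℝ)
    (hid : slotsOfRecord F N θ₀.ν θ₀.τ9 (EOfRecord₁₃ F N θ₀) (wOfRecord₉ F N θ₀.toStage9Params) θ₀.ppSel p (gOfRecord₁₃ F N θ₀ p) k s.init = 0 ∨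
      ∀ᵐ U₀ ∂fieldMeasure (F.P p.K) k (SU N),
        chiSeqOfRecord F N θ₀.ν θ₀.τ9.M (gOfRecord₁₃ F N θ₀ p) p.K k s.init U₀ ≠ 0 →
          slotsOfRecord F N θ₀.ν θ₀.τ9 (EOfRecord₁₃ F N θ₀) (wOfRecord₉ F N θ₀.toStage9Params) θ₀.ppSel p (gOfRecord₁₃ F N θ₀ p) k s.init U₀ =
            sect2Slot F N (FluctV N) p.K (settingOfRecord₁₃ F N θ₀ p) (θ₀.Rz p.K) (WtOfRecord₁₃R F N (Stage13RParams.ofCured F N θ₀) p) s.init t₀ E₀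
              (UbgOfRecord₁₃CoP F N θ₀ p k s.init) U₀)
    {C : ℝ}
    (hmB : Measurable fun U₀ : GaugeField (F.P p.K) k (SU N) =>
        tkBranchOfRecord F N (FluctV N) θ₀.ν θ₀.τ9.M _ p.K (WtOfRecord₁₃R F N (Stage13RParams.ofCured F N θ₀) p) s.init (fun _ => ∅) k
          (fun ω => sect2Operand F N (FluctV N) p.K (settingOfRecord₁₃ F N θ₀ p) (θ₀.Rz p.K) s.init t₀ E₀
            (UbgOfRecord₁₃CoP F N θ₀ p k s.init) ((fun _ => ∅ : ℕ → Set (Site (F.P p.K) 0)), fun j => (ω j).2) (fun j => (ω j).1))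
          (baseCfg (V := FluctV N) k U₀))
    (hCB : ∀ U₀ : GaugeField (F.P p.K) k (SU N),
      |tkBranchOfRecord F N (FluctV N) θ₀.ν θ₀.τ9.M _ p.K (WtOfRecord₁₃R F N (Stage13RParams.ofCured F N θ₀) p) s.init (fun _ => ∅) k
          (fun ω => sect2Operand F N (FluctV N) p.K (settingOfRecord₁₃ F N θ₀ p) (θ₀.Rz p.K) s.init t₀ E₀
            (UbgOfRecord₁₃CoP F N θ₀ p k s.init) ((fun _ => ∅ : ℕ → Set (Site (F.P p.K) 0)), fun j => (ω j).2) (fun j => (ω j).1))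
          (baseCfg (V := FluctV N) k U₀)| ≤ C)
    (t' : Sect2.TermValues (F.P p.K) (MatA N) (FluctV N) θ₀.τ9.M) :
    slotsTOfRecord F N θ₀.ν θ₀.τ9 (EOfRecord₁₃ F N θ₀) (wOfRecord₉ F N θ₀.toStage9Params) θ₀.ppSel p (gOfRecord₁₃ F N θ₀ p) (k + 1) s = 0 ∨
      ∀ᵐ V' ∂fieldMeasure (F.P p.K) (k + 1) (SU N),
        chiSeqOfRecord F N θ₀.ν θ₀.τ9.M (gOfRecord₁₃ F N θ₀ p) p.K (k + 1) s V' ≠ 0 →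
          slotsTOfRecord F N θ₀.ν θ₀.τ9 (EOfRecord₁₃ F N θ₀) (wOfRecord₉ F N θ₀.toStage9Params) θ₀.ppSel p (gOfRecord₁₃ F N θ₀ p) (k + 1) s V' =
            sect2Slot F N (FluctV N) p.K (settingOfRecord₁₃ F N θ₀ p) (θ₀.Rz p.K) (WtOfRecord₁₃R F N (Stage13RParams.ofCured F N θ₀) p) s t' E₀
              (UbgOfRecord₁₃CoP F N θ₀ p (k + 1) s) V' :=
  clause_succ_CoPR_of_provisos_of_clause (Stage13RParams.ofCured F N θ₀) p (Stage13RParams.ofCured_Zr F N θ₀ p) h.ofCured hk hM s hall t₀ E₀ hid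
    hmB hCB t'

end OfCured

end Summit.QuantumFields.YangMills.Theorems.BalabanUVNodesN11NoExpansionDiagonalClauseStep

end
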